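import Summits.Ventures.Crystal3D.Theorems.StickyWulffConstantCoaxialWallLawReadingDirectionsApex
import HarnessLib

/-!
# Reading directions IV: a module ball reads an OFF-MODULE APEX ball only as its host, in a reading direction
# (crux `CoaxialWallLaw`, stmt-Ventures-19481, line `WallLedgerF`; T4 brick, census-free)

HONEST FRAMING. Venture `Summits/Ventures/Crystal3D` (cell `crystal3d-full`); helper `--supports` the crux `CoaxialWallLaw`
(stmt-Ventures-19481, `route-Ventures-StickyWulffConstant`), REGISTERED line `WallLedgerF` (planner cf-p1, (xcv)(1): T4 pieces first).
Census-free; F-C1 not moved.  Continues `…ReadingDirectionsApex`: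
* `fineVec_sub`, `norm_fineVec_sq`, `neg_mem_readingDirs` (`V = −V`), `modSite_mem_coaxialModule`, `modSite_addSite`;
* `siteBox48`, `mem_siteBox48` (sites within `2` of `0`: `dsq12 ≤ 48`), `dsq12_le_of_norm_le_two`;
* `apexHost_table` / `apexRebase_table` (kernel `decide`, ≈ 11 000 quadratic checks): an OFF-module apex position over the adjacent menu pair `(a, b)`
  is at distance `1` from NO site within `2` other than its three hosts `0, a, b`; and the three host-to-apex vectors are in `VInt`;
* **`apex_contact_host`** — if a module ball `modSite q` touches the off-module apex ball `modSite y + apexVec (modSite a) (modSite b) up`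
  then `q ∈ {y, y + a, y + b}`; **`apex_contact_mem_readingDirs`** — and the contact direction is a reading direction (both ways,
  `apex_contact_mem_readingDirs'`); `not_mem_image_of_off_module` — the off-module hypothesis in the form `Realisable₂` supplies.
With `modSite_bond_mem_readingDirs` (III): every direction in which a MODULE ball reads an exact ball (module or rigid filler) of a
realisable type is a reading direction, so `stdFrame_of_reading_triangle` (II) applies to module-ball readers of exact balls.
WHAT THIS IS NOT: not the dust analysis, not type soundness; F-C1 not moved.
-/

noncomputable section

namespace Summit.Ventures.Crystal3D.Theorems

namespace TailResidue

open Summit.Ventures.Crystal3D Finset NearIdentity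
open Literature.MathematicalPhysics.StatisticalMechanics (triangularVec₁ triangularVec₂ barlowOffset layerNormal)
open scoped InnerProductSpace

/-! ### Small fine-vector facts -/

/-- Differences of fine vectors. -/
theorem fineVec_sub (t u : ℤ × ℤ × ℤ) : fineVec t - fineVec u = fineVec (t.1 - u.1, t.2.1 - u.2.1, t.2.2 - u.2.2) := by
  have h := fineVec_lin t u (-1)
  push_cast at h
  rw [neg_one_smul] at h
  rw [sub_eq_add_neg, ← h]
  congr 1
  ext <;> simp <;> ring

/-- Squared norms of fine vectors. -/
theorem norm_fineVec_sq (t : ℤ × ℤ × ℤ) : ‖fineVec t‖ ^ 2 = (dotI t t : ℝ) / 162 := by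
  rw [← real_inner_self_eq_norm_sq, inner_fineVec]

/-- Reading directions are unit vectors. -/
theorem norm_eq_one_of_mem_readingDirs {x : EuclideanSpace ℝ (Fin 3)} (hx : x ∈ readingDirs) : ‖x‖ = 1 := by
  obtain ⟨t, ht, rfl⟩ := hx
  have h : ‖fineVec t‖ ^ 2 = 1 := by rw [norm_fineVec_sq, vint_norm t ht]; norm_num
  nlinarith [norm_nonneg (fineVec t)]

/-- `V = −V`. -/
theorem neg_mem_readingDirs {x : EuclideanSpace ℝ (Fin 3)} (hx : x ∈ readingDirs) : -x ∈ readingDirs := by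
  have tab : ∀ t ∈ VInt, (-t.1, -t.2.1, -t.2.2) ∈ VInt := by decide
  obtain ⟨t, ht, rfl⟩ := hx
  refine ⟨_, tab t ht, ?_⟩
  have h := fineVec_lin (0, 0, 0) t (-1)
  have h0 : fineVec (0, 0, 0) = 0 := by simp [fineVec]
  simp only [zero_add, h0, Int.cast_neg, Int.cast_one, neg_one_smul] at h
  rw [← h]
  congr 1
  ext <;> simp

/-- Module sites lie on the coaxial module. -/
theorem modSite_mem_coaxialModule (s : ℤ × ℤ × ℤ) : modSite s ∈ coaxialModule 1 (Real.sqrt (2 / 3)) :=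
  ⟨s.1, 0, s.2.1, s.2.2, by simp [modSite]⟩

/-- `modSite` is additive. -/
theorem modSite_addSite (y a : ℤ × ℤ × ℤ) : modSite (addSite y a) = modSite y + modSite a := by
  simp only [modSite, addSite]
  push_cast
  module

/-! ### Sites within `2` of the payer -/

/-- The sites within distance `2` of `0` (`dsq12 ≤ 48`; `155` of them). -/
def siteBox48 : Finset (ℤ × ℤ × ℤ) :=
  ((Icc (-5 : ℤ) 5) ×ˢ ((Icc (-6 : ℤ) 6) ×ˢ (Icc (-2 : ℤ) 2))).filter fun s => dsq12 (0, 0, 0) s ≤ 48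

/-- Membership in `siteBox48` from the quadratic bound. -/
theorem mem_siteBox48 {d : ℤ × ℤ × ℤ} (h : dsq12 (0, 0, 0) d ≤ 48) : d ∈ siteBox48 := by
  obtain ⟨i, n, k⟩ := d
  have h' := h
  simp only [dsq12, sub_zero] at h'
  rw [siteBox48, Finset.mem_filter, Finset.mem_product, Finset.mem_product, Finset.mem_Icc, Finset.mem_Icc, Finset.mem_Icc]
  refine ⟨⟨⟨?_, ?_⟩, ⟨?_, ?_⟩, ⟨?_, ?_⟩⟩, h⟩ <;>
    nlinarith [sq_nonneg (2 * i + n), sq_nonneg n, sq_nonneg k, sq_nonneg (i + n), sq_nonneg i]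

/-- A module vector of length `≤ 2` has `dsq12 ≤ 48`. -/
theorem dsq12_le_of_norm_le_two {d : ℤ × ℤ × ℤ} (h : ‖modSite d‖ ≤ 2) : dsq12 (0, 0, 0) d ≤ 48 := by
  have hsq := norm_modSite_sq d
  have h4 : ‖modSite d‖ ^ 2 ≤ 4 := by nlinarith [norm_nonneg (modSite d)]
  have : (dsq12 (0, 0, 0) d : ℝ) ≤ 48 := by linarith
  exact_mod_cast this

/-! ### The apex–host table -/

set_option maxRecDepth 65536 in
/-- **THE APEX–HOST TABLE** (kernel `decide`, ≈ 11 000 quadratic checks): for every adjacent menu pair `(a, b)` and side, if the apex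
position is off the menu (`apexFine ∉ siteFine '' menuOffsets`, i.e. off-module), then every site `d` within `2` of `0` with
`|siteFine d − apexFine|² = 162` is one of the hosts `0, a, b`. -/
theorem apexHost_table : ∀ p ∈ menuPairs ×ˢ (Finset.univ : Finset Bool),
    apexFine p.1.1 p.1.2 p.2 ∉ menuOffsets.image siteFine →
      ∀ d ∈ siteBox48,
        dotI ((siteFine d).1 - (apexFine p.1.1 p.1.2 p.2).1, (siteFine d).2.1 - (apexFine p.1.1 p.1.2 p.2).2.1,
            (siteFine d).2.2 - (apexFine p.1.1 p.1.2 p.2).2.2)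
          ((siteFine d).1 - (apexFine p.1.1 p.1.2 p.2).1, (siteFine d).2.1 - (apexFine p.1.1 p.1.2 p.2).2.1,
            (siteFine d).2.2 - (apexFine p.1.1 p.1.2 p.2).2.2) = 162 →
        d = (0, 0, 0) ∨ d = p.1.1 ∨ d = p.1.2 := by
  decide

set_option maxRecDepth 65536 in
/-- The RE-BASED apex vectors (apex minus the hosts `a`, `b`) lie in `VInt` (kernel `decide`). -/
theorem apexRebase_table : ∀ p ∈ menuPairs ×ˢ (Finset.univ : Finset Bool),
    ((apexFine p.1.1 p.1.2 p.2).1 - (siteFine p.1.1).1, (apexFine p.1.1 p.1.2 p.2).2.1 - (siteFine p.1.1).2.1,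
        (apexFine p.1.1 p.1.2 p.2).2.2 - (siteFine p.1.1).2.2) ∈ VInt ∧
    ((apexFine p.1.1 p.1.2 p.2).1 - (siteFine p.1.2).1, (apexFine p.1.1 p.1.2 p.2).2.1 - (siteFine p.1.2).2.1,
        (apexFine p.1.1 p.1.2 p.2).2.2 - (siteFine p.1.2).2.2) ∈ VInt := by
  decide

set_option maxRecDepth 65536 in
/-- Pairing a menu pair with a side. -/
theorem mem_menuPairs_univ {a b : ℤ × ℤ × ℤ} (hab : (a, b) ∈ menuPairs) (up : Bool) :
    ((a, b), up) ∈ menuPairs ×ˢ (Finset.univ : Finset Bool) :=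
  Finset.mem_product.2 ⟨hab, Finset.mem_univ _⟩

set_option maxRecDepth 65536 in
/-- The off-module hypothesis of `Realisable₂` in table form: an apex point off the coaxial module is off the menu. -/
theorem not_mem_image_of_off_module {y a b : ℤ × ℤ × ℤ} {up : Bool} (hab : (a, b) ∈ menuPairs)
    (hoff : modSite y + apexVec (modSite a) (modSite b) up ∉ coaxialModule 1 (Real.sqrt (2 / 3))) :
    apexFine a b up ∉ menuOffsets.image siteFine := by
  intro h
  rw [Finset.mem_image] at h
  obtain ⟨m, -, hm⟩ := h
  apply hoff
  rw [apexVec_modSite hab, ← hm, ← modSite_eq_fineVec, ← modSite_addSite]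
  exact modSite_mem_coaxialModule _

/-! ### A module ball touching an off-module apex ball is one of its hosts -/

set_option maxRecDepth 65536 in
/-- The contact vector in fine coordinates. -/
theorem modSite_sub_apex_eq {q y a b : ℤ × ℤ × ℤ} (hab : (a, b) ∈ menuPairs) (up : Bool) :
    modSite q - (modSite y + apexVec (modSite a) (modSite b) up) =
      fineVec ((siteFine (q.1 - y.1, q.2.1 - y.2.1, q.2.2 - y.2.2)).1 - (apexFine a b up).1,
        (siteFine (q.1 - y.1, q.2.1 - y.2.1, q.2.2 - y.2.2)).2.1 - (apexFine a b up).2.1,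
        (siteFine (q.1 - y.1, q.2.1 - y.2.1, q.2.2 - y.2.2)).2.2 - (apexFine a b up).2.2) := by
  rw [← sub_sub, modSite_sub, apexVec_modSite hab, modSite_eq_fineVec, fineVec_sub]

set_option maxRecDepth 65536 in
/-- **A module ball touching an off-module apex ball is one of its three hosts.** -/
theorem apex_contact_host {q y a b : ℤ × ℤ × ℤ} {up : Bool} (hab : (a, b) ∈ menuPairs)
    (hoff : apexFine a b up ∉ menuOffsets.image siteFine)
    (h : dist (modSite q) (modSite y + apexVec (modSite a) (modSite b) up) = 1) :
    q = y ∨ q = addSite y a ∨ q = addSite y b := by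
  set d : ℤ × ℤ × ℤ := (q.1 - y.1, q.2.1 - y.2.1, q.2.2 - y.2.2) with hd
  have hvec := modSite_sub_apex_eq (q := q) (y := y) hab up
  rw [← hd] at hvec
  -- the integer equation
  have h162 : dotI ((siteFine d).1 - (apexFine a b up).1, (siteFine d).2.1 - (apexFine a b up).2.1,
      (siteFine d).2.2 - (apexFine a b up).2.2) ((siteFine d).1 - (apexFine a b up).1,
      (siteFine d).2.1 - (apexFine a b up).2.1, (siteFine d).2.2 - (apexFine a b up).2.2) = 162 := by
    have hn : ‖modSite q - (modSite y + apexVec (modSite a) (modSite b) up)‖ = 1 := by rw [← dist_eq_norm, h]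
    rw [hvec] at hn
    have hsq := norm_fineVec_sq ((siteFine d).1 - (apexFine a b up).1, (siteFine d).2.1 - (apexFine a b up).2.1,
      (siteFine d).2.2 - (apexFine a b up).2.2)
    rw [hn, one_pow] at hsq
    have : (dotI ((siteFine d).1 - (apexFine a b up).1, (siteFine d).2.1 - (apexFine a b up).2.1,
        (siteFine d).2.2 - (apexFine a b up).2.2) ((siteFine d).1 - (apexFine a b up).1,
        (siteFine d).2.1 - (apexFine a b up).2.1, (siteFine d).2.2 - (apexFine a b up).2.2) : ℝ) = 162 := by
      linarith
    exact_mod_cast this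
  -- the bound `dsq12 0 d ≤ 48`
  have hF : ‖fineVec (apexFine a b up)‖ = 1 :=
    norm_eq_one_of_mem_readingDirs ⟨_, (apexFine_table (a, b) hab).2.2.elim (fun ht hf => by cases up <;> assumption), rfl⟩
  have hbound : ‖modSite d‖ ≤ 2 := by
    have e : modSite d = (modSite q - (modSite y + apexVec (modSite a) (modSite b) up)) + fineVec (apexFine a b up) := by
      rw [← sub_sub, modSite_sub, ← hd, apexVec_modSite hab, sub_add_cancel]
    rw [e]
    calc ‖modSite q - (modSite y + apexVec (modSite a) (modSite b) up) + fineVec (apexFine a b up)‖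
        ≤ ‖modSite q - (modSite y + apexVec (modSite a) (modSite b) up)‖ + ‖fineVec (apexFine a b up)‖ := norm_add_le _ _
      _ = 2 := by rw [← dist_eq_norm, h, hF]; norm_num
  have hbox := mem_siteBox48 (dsq12_le_of_norm_le_two hbound)
  -- the table
  have htab := apexHost_table _ (mem_menuPairs_univ hab up) hoff d hbox h162
  dsimp only at htab
  rw [hd, Prod.ext_iff, Prod.ext_iff, Prod.ext_iff, Prod.ext_iff, Prod.ext_iff, Prod.ext_iff] at htab
  dsimp only at htab
  rcases htab with ⟨h1, h2, h3⟩ | ⟨h1, h2, h3⟩ | ⟨h1, h2, h3⟩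
  · left
    ext <;> omega
  · right; left
    simp only [addSite]
    ext <;> dsimp only <;> omega
  · right; right
    simp only [addSite]
    ext <;> dsimp only <;> omega

set_option maxRecDepth 65536 in
/-- **The contact direction (apex minus module ball) is a reading direction.** -/
theorem apex_contact_mem_readingDirs {q y a b : ℤ × ℤ × ℤ} {up : Bool} (hab : (a, b) ∈ menuPairs)
    (hoff : apexFine a b up ∉ menuOffsets.image siteFine)
    (h : dist (modSite q) (modSite y + apexVec (modSite a) (modSite b) up) = 1) :
    modSite y + apexVec (modSite a) (modSite b) up - modSite q ∈ readingDirs := by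
  obtain ⟨-, -, ht, hf⟩ := apexFine_table (a, b) hab
  obtain ⟨ha', hb'⟩ := apexRebase_table _ (mem_menuPairs_univ hab up)
  dsimp only at ht hf ha' hb'
  rcases apex_contact_host hab hoff h with rfl | rfl | rfl
  · rw [add_sub_cancel_left, apexVec_modSite hab]
    cases up
    · exact ⟨_, hf, rfl⟩
    · exact ⟨_, ht, rfl⟩
  · refine ⟨_, ha', ?_⟩
    rw [modSite_addSite, add_sub_add_left_eq_sub, apexVec_modSite hab, modSite_eq_fineVec, fineVec_sub]
  · refine ⟨_, hb', ?_⟩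
    rw [modSite_addSite, add_sub_add_left_eq_sub, apexVec_modSite hab, modSite_eq_fineVec, fineVec_sub]

set_option maxRecDepth 65536 in
/-- The same direction read from the apex ball (module ball minus apex). -/
theorem apex_contact_mem_readingDirs' {q y a b : ℤ × ℤ × ℤ} {up : Bool} (hab : (a, b) ∈ menuPairs)
    (hoff : apexFine a b up ∉ menuOffsets.image siteFine)
    (h : dist (modSite q) (modSite y + apexVec (modSite a) (modSite b) up) = 1) :
    modSite q - (modSite y + apexVec (modSite a) (modSite b) up) ∈ readingDirs := by
  rw [← neg_sub]
  exact neg_mem_readingDirs (apex_contact_mem_readingDirs hab hoff h)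

end TailResidue

end Summit.Ventures.Crystal3D.Theorems

end
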